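import Summits.Schanuel.Schanuel.Theorems.ZilberEacNewtonPolygon
import HarnessLib

/-!
# The equimodular class, LXIX: the Newton–Puiseux step preserves SQUAREFREENESS — transport of a
# Bézout element `A F + B ∂_yF = r(x)` along `x = t^k, y = t^μ w` and along translations; the bound
# `λ(m - 1) ≤ ord₀ r` in the totally degenerate case

HONEST FRAMING.  Cell `pub-schanuel` (Zilber's Exponential-Algebraic Closedness, case ladder;
host summit Schanuel), seat 2, gen 26.  Second brick of the Newton–Puiseux existence theorem (file
LXX).  The induction carries a witness `A F + B ∂_yF = C r`, `r ≠ 0` (no multiple factors).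
* **`eval_eval_eq_evalPP`** — `(P.eval q).eval t = P(t, q(t))` (outer evaluation at an inner
  polynomial);
* **`deriv_identity_of_newtonDatum`** — from `F(t^k, t^μ w) = t^ν G(t, w)`:
  `t^μ ∂_yF(t^k, t^μ w) = t^ν ∂_wG(t, w)`;
* **`exists_bezout_of_newtonDatum`** — a Bézout element for `G`: `A' G + B' ∂_wG = C r'`;
* **`bezout_comp_X_add_C`** — Bézout elements survive `y ↦ y + q(x)`;
* **`mul_le_rootMultiplicity_of_newtonDatum`** — in a datum with `k = 1` and `ν = λ m`:
  `λ (m - 1) ≤ ord₀ r` (the bound that makes the translation loop terminate).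
[folklore (Newton–Puiseux), made concrete]; nothing here is specific to Schanuel's conjecture
(neither used nor implied); Mantova–Masser's question (PLMS 2024 §1 p. 5) and EC(3,2) stay OPEN.
-/

noncomputable section

open Polynomial

set_option linter.dupNamespace false

namespace Summit.Schanuel.Schanuel.Theorems

/-! ## Part A. Evaluation bookkeeping -/

/-- **Outer evaluation at an inner polynomial**: `(P.eval q).eval t = P(t, q(t))`. [folklore] -/
theorem eval_eval_eq_evalPP (P : ℂ[X][X]) (q : ℂ[X]) (t : ℂ) :
    (P.eval q).eval t = (P.map (Polynomial.evalRingHom t)).eval (q.eval t) := by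
  induction P using Polynomial.induction_on' with
  | add p q' hp hq => rw [Polynomial.eval_add, Polynomial.eval_add, hp, hq, Polynomial.map_add,
      Polynomial.eval_add]
  | monomial n a =>
    rw [Polynomial.eval_monomial, Polynomial.eval_mul, Polynomial.eval_pow, Polynomial.map_monomial,
      Polynomial.eval_monomial, Polynomial.coe_evalRingHom]

/-- The two-variable evaluation of `C r` is `r(t)`. [folklore] -/
theorem evalPP_C (r : ℂ[X]) (t w : ℂ) :
    ((Polynomial.C r : ℂ[X][X]).map (Polynomial.evalRingHom t)).eval w = r.eval t := by
  rw [Polynomial.map_C, Polynomial.eval_C, Polynomial.coe_evalRingHom]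

/-! ## Part B. The derivative along a Newton–Puiseux datum -/

/-- **`t^μ ∂_yF(a + t^k, t^μ w) = t^ν ∂_wG(t, w)`** whenever `F(a + t^k, t^μ w) = t^ν G(t, w)` for all
`t, w` (differentiate the polynomial identity in `w`). [folklore] -/
theorem deriv_identity_of_newtonDatum {F G : ℂ[X][X]} {a : ℂ} {k μ ν : ℕ}
    (hid : ∀ t w : ℂ, (F.map (Polynomial.evalRingHom (a + t ^ k))).eval (t ^ μ * w) =
      t ^ ν * (G.map (Polynomial.evalRingHom t)).eval w) (t w : ℂ) :
    t ^ μ * ((derivative F).map (Polynomial.evalRingHom (a + t ^ k))).eval (t ^ μ * w) =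
      t ^ ν * ((derivative G).map (Polynomial.evalRingHom t)).eval w := by
  set P₁ : ℂ[X] := (F.map (Polynomial.evalRingHom (a + t ^ k))).comp (Polynomial.C (t ^ μ) * Polynomial.X)
    with hP₁
  set P₂ : ℂ[X] := Polynomial.C (t ^ ν) * G.map (Polynomial.evalRingHom t) with hP₂
  have hP : P₁ = P₂ := by
    refine Polynomial.funext fun w' => ?_
    rw [hP₁, hP₂, Polynomial.eval_comp, Polynomial.eval_mul, Polynomial.eval_C, Polynomial.eval_X,
      Polynomial.eval_mul, Polynomial.eval_C]
    exact hid t w'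
  have h := congrArg (fun P : ℂ[X] => (derivative P).eval w) hP
  simp only [hP₁, hP₂, Polynomial.derivative_comp, Polynomial.derivative_mul, Polynomial.derivative_C,
    zero_mul, zero_add, Polynomial.derivative_X, mul_one, Polynomial.derivative_map,
    Polynomial.eval_mul, Polynomial.eval_C, Polynomial.eval_comp, Polynomial.eval_X] at h
  linear_combination h

/-! ## Part C. Bézout elements along a datum and along translations -/

/-- Every nonzero complex number is a `k`-th power (`k ≥ 1`); hence a polynomial vanishing at all
`t^k`, `t ≠ 0`, is zero. [folklore] -/
theorem eq_zero_of_eval_pow_eq_zero {r : ℂ[X]} {k : ℕ} (hk : 1 ≤ k)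
    (h : ∀ t : ℂ, t ≠ 0 → r.eval (t ^ k) = 0) : r = 0 := by
  by_contra hr
  have hinf : Set.Infinite {x : ℂ | r.eval x = 0 ∧ True} := by
    refine ((Set.finite_singleton (0 : ℂ)).infinite_compl).mono ?_
    intro x hx
    simp only [Set.mem_compl_iff, Set.mem_singleton_iff] at hx
    obtain ⟨t, ht⟩ := IsAlgClosed.exists_pow_nat_eq x (by omega : 0 < k)
    have ht0 : t ≠ 0 := by rintro rfl; rw [zero_pow (by omega)] at ht; exact hx ht.symm
    exact ⟨by rw [← ht]; exact h t ht0, trivial⟩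
  have hfin : Set.Finite {x : ℂ | r.eval x = 0 ∧ True} := by
    refine (r.roots.toFinset.finite_toSet).subset fun x hx => ?_
    simp only [Set.mem_setOf_eq] at hx
    simp only [Finset.mem_coe, Multiset.mem_toFinset]
    exact (Polynomial.mem_roots hr).2 hx.1
  exact hinf hfin

/-- **Bézout elements along a Newton–Puiseux datum.**  `A F + B ∂_yF = C r` (`r ≠ 0`),
`F(a + t^k, t^μ w) = t^ν G(t, w)` for all `t, w` (`k ≥ 1`) ⟹ `A' G + B' ∂_wG = C r'` with
`r' ≠ 0`. [folklore] -/
theorem exists_bezout_of_newtonDatum {F G A B : ℂ[X][X]} {r : ℂ[X]} (hr : r ≠ 0)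
    (hbez : A * F + B * derivative F = Polynomial.C r) {a : ℂ} {k μ ν : ℕ} (hk : 1 ≤ k)
    (hid : ∀ t w : ℂ, (F.map (Polynomial.evalRingHom (a + t ^ k))).eval (t ^ μ * w) =
      t ^ ν * (G.map (Polynomial.evalRingHom t)).eval w) :
    ∃ (A' B' : ℂ[X][X]) (r' : ℂ[X]), r' ≠ 0 ∧ A' * G + B' * derivative G = Polynomial.C r' := by
  classical
  -- the substituted cofactors `σA · t^μ` and `σB`
  set φ : ℂ[X] →+* ℂ[X] := Polynomial.compRingHom (Polynomial.C a + Polynomial.X ^ k) with hφ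
  set σ : ℂ[X][X] → ℂ[X][X] := fun P => (P.map φ).comp (Polynomial.C (Polynomial.X ^ μ) * Polynomial.X) with hσ
  have hσeval : ∀ (P : ℂ[X][X]) (t w : ℂ), ((σ P).map (Polynomial.evalRingHom t)).eval w =
      (P.map (Polynomial.evalRingHom (a + t ^ k))).eval (t ^ μ * w) := by
    intro P t w
    simp only [hσ]
    rw [Polynomial.map_comp, Polynomial.eval_comp, Polynomial.map_map]
    have hcomp : (Polynomial.evalRingHom t).comp φ = Polynomial.evalRingHom (a + t ^ k) := by
      refine RingHom.ext fun q => ?_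
      rw [RingHom.comp_apply, hφ, Polynomial.coe_compRingHom_apply, Polynomial.coe_evalRingHom,
        Polynomial.coe_evalRingHom, Polynomial.eval_comp, Polynomial.eval_add, Polynomial.eval_C,
        Polynomial.eval_pow, Polynomial.eval_X]
    rw [hcomp]
    congr 1
    simp [Polynomial.map_mul, Polynomial.map_X, Polynomial.map_C]
  set A' : ℂ[X][X] := σ A * Polynomial.C (Polynomial.X ^ μ) with hA'
  set B' : ℂ[X][X] := σ B with hB'
  set H : ℂ[X][X] := A' * G + B' * derivative G with hH
  set r' : ℂ[X] := H.coeff 0 with hr'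
  -- `t^ν H(t, w) = t^μ r(a + t^k)`
  have hHeval : ∀ t w : ℂ, t ^ ν * (H.map (Polynomial.evalRingHom t)).eval w = t ^ μ * r.eval (a + t ^ k) := by
    intro t w
    have hb := congrArg (fun P : ℂ[X][X] => (P.map (Polynomial.evalRingHom (a + t ^ k))).eval (t ^ μ * w)) hbez
    simp only [Polynomial.map_add, Polynomial.map_mul, Polynomial.eval_add, Polynomial.eval_mul, evalPP_C] at hb
    have hd := deriv_identity_of_newtonDatum hid t w
    rw [hH, hA', hB']
    simp only [Polynomial.map_add, Polynomial.map_mul, Polynomial.eval_add, Polynomial.eval_mul, hσeval,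
      Polynomial.map_C, Polynomial.eval_C, Polynomial.coe_evalRingHom, Polynomial.eval_pow, Polynomial.eval_X]
    rw [← hb, hid t w]
    linear_combination -(B.map (Polynomial.evalRingHom (a + t ^ k))).eval (t ^ μ * w) * hd
  -- `H(t, w) = r'(t)`: independent of `w`
  have hHr' : ∀ t w : ℂ, (H.map (Polynomial.evalRingHom t)).eval w = r'.eval t := by
    intro t w
    have hcoef0 : ∀ s : ℂ, (H.map (Polynomial.evalRingHom s)).eval 0 = r'.eval s := fun s => by
      rw [← Polynomial.coeff_zero_eq_eval_zero, Polynomial.coeff_map, hr', Polynomial.coe_evalRingHom]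
    -- the polynomial in `t`, `w` fixed
    have hpoly : (H.eval (Polynomial.C w) - H.eval (Polynomial.C 0) : ℂ[X]) = 0 := by
      refine Polynomial.eq_of_infinite_eval_eq _ _ ?_
      refine ((Set.finite_singleton (0 : ℂ)).infinite_compl).mono fun s hs => ?_
      simp only [Set.mem_compl_iff, Set.mem_singleton_iff] at hs
      simp only [Set.mem_setOf_eq, Polynomial.eval_sub, Polynomial.eval_zero, eval_eval_eq_evalPP,
        Polynomial.eval_C]
      have h1 := hHeval s w
      have h2 := hHeval s 0
      have hsν : s ^ ν ≠ 0 := pow_ne_zero _ hs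
      have : (H.map (Polynomial.evalRingHom s)).eval w = (H.map (Polynomial.evalRingHom s)).eval 0 :=
        mul_left_cancel₀ hsν (by rw [h1, h2])
      rw [this, sub_self]
    have h := congrArg (Polynomial.eval t) hpoly
    rw [Polynomial.eval_sub, Polynomial.eval_zero, eval_eval_eq_evalPP, eval_eval_eq_evalPP,
      Polynomial.eval_C, Polynomial.eval_C, sub_eq_zero] at h
    rw [h, hcoef0]
  refine ⟨A', B', r', ?_, ?_⟩
  · -- `r' ≠ 0`
    intro h0
    apply hr
    have hzero : ∀ t : ℂ, t ≠ 0 → (r.comp (Polynomial.C a + Polynomial.X)).eval (t ^ k) = 0 := by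
      intro t ht
      have h := hHeval t 0
      rw [hHr', h0, Polynomial.eval_zero, mul_zero] at h
      rw [Polynomial.eval_comp, Polynomial.eval_add, Polynomial.eval_C, Polynomial.eval_X]
      exact (mul_eq_zero.1 h.symm).resolve_left (pow_ne_zero _ ht)
    have hc := eq_zero_of_eval_pow_eq_zero hk hzero
    have h2 : r = (r.comp (Polynomial.C a + Polynomial.X)).comp (Polynomial.X - Polynomial.C a) := by
      rw [Polynomial.comp_assoc]; simp
    rw [h2, hc, Polynomial.zero_comp]
  · refine polyPoly_eq_of_eval_eq fun t w => ?_
    rw [← hH, hHr' t w, evalPP_C]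

/-- **Bézout elements survive a translation `y ↦ y + q(x)`.** [folklore] -/
theorem bezout_comp_X_add_C {F A B : ℂ[X][X]} {r : ℂ[X]} (hbez : A * F + B * derivative F = Polynomial.C r)
    (q : ℂ[X]) :
    A.comp (Polynomial.X + Polynomial.C q) * F.comp (Polynomial.X + Polynomial.C q) +
      B.comp (Polynomial.X + Polynomial.C q) * derivative (F.comp (Polynomial.X + Polynomial.C q)) =
      Polynomial.C r := by
  have hτ' : derivative (Polynomial.X + Polynomial.C q : ℂ[X][X]) = 1 := by
    rw [Polynomial.derivative_add, Polynomial.derivative_X, Polynomial.derivative_C, add_zero]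
  rw [Polynomial.derivative_comp, hτ', one_mul]
  have h := congrArg (fun P : ℂ[X][X] => P.comp (Polynomial.X + Polynomial.C q)) hbez
  simp only [Polynomial.add_comp, Polynomial.mul_comp, Polynomial.C_comp] at h
  exact h

/-! ## Part D. The bound in the totally degenerate case -/

/-- **`λ (m - 1) ≤ ord₀ r`.**  If `A F + B ∂_yF = C r`, `r ≠ 0`, and `F(t, t^λ w) = t^{λ m} G(t, w)`
for all `t, w` (`m ≥ 1`), then `X^{λ(m-1)} ∣ r`: `r(t) = A·t^{λm}G(t,1) + B·t^{λ(m-1)}∂_wG(t,1)`.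
[folklore] -/
theorem mul_le_rootMultiplicity_of_newtonDatum {F G A B : ℂ[X][X]} {r : ℂ[X]} (hr : r ≠ 0)
    (hbez : A * F + B * derivative F = Polynomial.C r) {lam m : ℕ} (hm : 1 ≤ m)
    (hid : ∀ t w : ℂ, (F.map (Polynomial.evalRingHom (0 + t ^ 1))).eval (t ^ lam * w) =
      t ^ (lam * m) * (G.map (Polynomial.evalRingHom t)).eval w) :
    lam * (m - 1) ≤ Polynomial.rootMultiplicity 0 r := by
  -- `r(t) = t^{λ(m-1)} h(t)` with an explicit polynomial `h`
  set h : ℂ[X] := A.eval (Polynomial.X ^ lam) * Polynomial.X ^ lam * G.eval (Polynomial.C 1) +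
    B.eval (Polynomial.X ^ lam) * (derivative G).eval (Polynomial.C 1) with hh
  have hpow : lam * m = lam + lam * (m - 1) := by
    obtain ⟨m', rfl⟩ : ∃ m', m = m' + 1 := ⟨m - 1, by omega⟩
    simp [Nat.mul_succ, Nat.add_comm]
  have heq : ∀ t : ℂ, t ≠ 0 → r.eval t = (Polynomial.X ^ (lam * (m - 1)) * h).eval t := by
    intro t ht
    have hb := congrArg (fun P : ℂ[X][X] => (P.map (Polynomial.evalRingHom t)).eval (t ^ lam * 1)) hbez
    simp only [Polynomial.map_add, Polynomial.map_mul, Polynomial.eval_add, Polynomial.eval_mul, evalPP_C] at hb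
    have hid' : ∀ w : ℂ, (F.map (Polynomial.evalRingHom t)).eval (t ^ lam * w) =
        t ^ (lam * m) * (G.map (Polynomial.evalRingHom t)).eval w := fun w => by
      have := hid t w; rwa [pow_one, zero_add] at this
    have hd : t ^ lam * ((derivative F).map (Polynomial.evalRingHom t)).eval (t ^ lam * 1) =
        t ^ (lam * m) * ((derivative G).map (Polynomial.evalRingHom t)).eval 1 := by
      have := deriv_identity_of_newtonDatum hid t 1; rwa [pow_one, zero_add] at this
    have hd' : ((derivative F).map (Polynomial.evalRingHom t)).eval (t ^ lam * 1) =
        t ^ (lam * (m - 1)) * ((derivative G).map (Polynomial.evalRingHom t)).eval 1 := by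
      refine mul_left_cancel₀ (pow_ne_zero lam ht) ?_
      rw [hd, hpow, pow_add]; ring
    rw [← hb, hid' 1, hd', hh]
    simp only [Polynomial.eval_add, Polynomial.eval_mul, Polynomial.eval_pow, Polynomial.eval_X,
      eval_eval_eq_evalPP, Polynomial.eval_C, mul_one]
    rw [hpow, pow_add]
    ring
  have hreq : r = Polynomial.X ^ (lam * (m - 1)) * h := by
    refine Polynomial.eq_of_infinite_eval_eq _ _ ?_
    refine ((Set.finite_singleton (0 : ℂ)).infinite_compl).mono fun t ht => ?_
    simp only [Set.mem_compl_iff, Set.mem_singleton_iff] at ht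
    exact heq t ht
  rw [Polynomial.le_rootMultiplicity_iff hr, map_zero, sub_zero]
  exact ⟨h, hreq⟩

end Summit.Schanuel.Schanuel.Theorems
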